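import Summits.CriticalPhenomena.PercolationContinuityZ3.Theorems.PercNearOneGluingNoHeavyLowerTailThreePointProductFormFibreApexTransfer
import HarnessLib

/-!
# The product form in the fibre language: apex transfer (R1) for the inequalities (S1J), (S1J′)
# (Sahi programme, prover prim-sahi-p2 gen 56)

Support file (`--supports stmt-CriticalPhenomena-4575`, helper); companion of `…ThreePointProductFormFibreApexTransfer` (gen 55: R1 for (P)).
Standard axioms, no sorries, no named facts, no definitions.  Memo `run/shared/lean/prim/prim-sahi/FROM-prim-sahi-p2-gen56-REFINED-PRODUCT-FORM.md` §10.

SETTING of R1: the cut vertex `u ∉ A` separates the apex side `A ∋ a` from the rest; `s, c ∉ A ∪ {u}`.  Pointwise, with `♭ₐ = ♭ᵤ` on `{a ↔ u}`: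
`w(a) = {a ↔ u} ∩ w(u)` (`w_iff_apexTransfer`), `w′(a) = {a ↔ u} ∩ w′(u)`, `J(a) = {a ↔ u} ∩ J(u)` (`joined_iff_apexTransfer`), and `bad`, `P1`, `P2`
likewise (gen 55); the independence count multiplies every count by `#{a ↔ u}/#univ`, so each degree-2 homogeneous inequality transfers:
* **`S1J_of_apexTransfer`** [this work] — `(S1J)` for `(s, u, c)` ⟹ `(S1J)` for `(s, a, c)`: `(#bad + w)² ≤ #P1 · #J`;
* **`S1Jc_of_apexTransfer`** [this work] — the same for `(S1J′)`: `(#bad + w′)² ≤ #P2 · #J`.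
With `productForm_of_apexTransfer`, the system `𝒮 = {(P), (S1J), (S1J′)}` transfers across R1.  [folklore] (product counting);
[cite: Gladkov2024, Conjecture 10.1 (p. 18), arXiv:2408.08457] for CONJECTURE (P) served.
-/

namespace Summit.CriticalPhenomena.PercolationContinuityZ3.Theorems.ProductFormFibre

open Finset Literature.Probability.Percolation
open Summit.CriticalPhenomena.PercolationContinuityZ3.Theorems.ThreePointCPIClusterSwap (clusterFlip)

variable {V α : Type*}

section PointwiseR1

variable (ends : α → Sym2 V) (u : V) (A : Set V) [DecidableEq V]

/-- **`J(a) = {a ↔ u} ∩ J(u)` pointwise.** [this work] -/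
theorem joined_iff_apexTransfer
    (hsep : ∀ l : α, (∀ v ∈ ends l, v ∈ A ∨ v = u) ∨ (∀ v ∈ ends l, v ∉ A ∨ v = u)) (huA : u ∉ A)
    {a s c : V} (ha : a ∈ A) (hs : s ∉ A) (hc : c ∉ A) (z : α → Bool) :
    ((openGraph (labelledOpen ends z)).Reachable a s ∧ (openGraph (labelledOpen ends z)).Reachable a c) ↔
    ((openGraph (labelledOpen ends z)).Reachable a u ∧
      ((openGraph (labelledOpen ends z)).Reachable u s ∧ (openGraph (labelledOpen ends z)).Reachable u c)) := by
  constructor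
  · rintro ⟨h1, h2⟩
    have h := (reachable_cut_iff ends u A hsep huA z ha hs).1 h1
    have h' := (reachable_cut_iff ends u A hsep huA z ha hc).1 h2
    exact ⟨h.1, h.2, h'.2⟩
  · rintro ⟨hau, h1, h2⟩
    exact ⟨hau.trans h1, hau.trans h2⟩

/-- **`w(a) = {a ↔ u} ∩ w(u)` pointwise** (`P1`-states whose flat joins `s` to `c`); with `s, c` exchanged this is the statement for `w′`. [this work] -/
theorem w_iff_apexTransfer
    (hsep : ∀ l : α, (∀ v ∈ ends l, v ∈ A ∨ v = u) ∨ (∀ v ∈ ends l, v ∉ A ∨ v = u)) (huA : u ∉ A)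
    {a s c : V} (ha : a ∈ A) (hs : s ∉ A) (z : α → Bool) :
    (((openGraph (labelledOpen ends z)).Reachable a s ∧ ¬ (openGraph (labelledOpen ends z)).Reachable a c) ∧
      (openGraph (labelledOpen ends (clusterFlip ends a fun x => !z x))).Reachable s c) ↔
    ((openGraph (labelledOpen ends z)).Reachable a u ∧
      (((openGraph (labelledOpen ends z)).Reachable u s ∧ ¬ (openGraph (labelledOpen ends z)).Reachable u c) ∧
        (openGraph (labelledOpen ends (clusterFlip ends u fun x => !z x))).Reachable s c)) := by
  rw [show (((openGraph (labelledOpen ends z)).Reachable a s ∧ ¬ (openGraph (labelledOpen ends z)).Reachable a c) ∧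
      (openGraph (labelledOpen ends (clusterFlip ends a fun x => !z x))).Reachable s c) ↔
    (((openGraph (labelledOpen ends z)).Reachable a u ∧
      ((openGraph (labelledOpen ends z)).Reachable u s ∧ ¬ (openGraph (labelledOpen ends z)).Reachable u c)) ∧
      (openGraph (labelledOpen ends (clusterFlip ends a fun x => !z x))).Reachable s c) from
    and_congr_left' (sa_iff_apexTransfer ends u A hsep huA (c := c) ha hs z)]
  constructor
  · rintro ⟨⟨hau, h1⟩, h2⟩
    refine ⟨hau, h1, ?_⟩
    rwa [← flat_eq_flat_of_reachable ends z hau]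
  · rintro ⟨hau, h1, h2⟩
    refine ⟨⟨hau, h1⟩, ?_⟩
    rwa [flat_eq_flat_of_reachable ends z hau]

end PointwiseR1

section TransferS1J

variable [Fintype α] [DecidableEq α] [DecidableEq V]

open Classical in
/-- **(S1J) TRANSFERS ACROSS R1.**  If `(#bad + w)² ≤ #P1 · #J` holds for the terminals `(s, u, c)` with apex `u` (on the same multigraph), then it
holds for `(s, a, c)`. [this work] -/
theorem S1J_of_apexTransfer (ends : α → Sym2 V) (u a s c : V) (A : Set V)
    (hsep : ∀ l : α, (∀ v ∈ ends l, v ∈ A ∨ v = u) ∨ (∀ v ∈ ends l, v ∉ A ∨ v = u))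
    (huA : u ∉ A) (ha : a ∈ A) (hs : s ∉ A) (hsu : s ≠ u) (hc : c ∉ A) (hcu : c ≠ u)
    (hS : ((univ.filter fun z : α → Bool =>
        (¬ (openGraph (labelledOpen ends z)).Reachable u s ∧ ¬ (openGraph (labelledOpen ends z)).Reachable u c ∧
            ¬ (openGraph (labelledOpen ends z)).Reachable s c) ∧
          (openGraph (labelledOpen ends (clusterFlip ends u fun x => !z x))).Reachable s c).card +
        (univ.filter fun z : α → Bool =>
          ((openGraph (labelledOpen ends z)).Reachable u s ∧ ¬ (openGraph (labelledOpen ends z)).Reachable u c) ∧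
            (openGraph (labelledOpen ends (clusterFlip ends u fun x => !z x))).Reachable s c).card) ^ 2 ≤
      (univ.filter fun z : α → Bool =>
        (openGraph (labelledOpen ends z)).Reachable u s ∧ ¬ (openGraph (labelledOpen ends z)).Reachable u c).card *
      (univ.filter fun z : α → Bool =>
        (openGraph (labelledOpen ends z)).Reachable u s ∧ (openGraph (labelledOpen ends z)).Reachable u c).card) :
    ((univ.filter fun z : α → Bool =>
        (¬ (openGraph (labelledOpen ends z)).Reachable a s ∧ ¬ (openGraph (labelledOpen ends z)).Reachable a c ∧
            ¬ (openGraph (labelledOpen ends z)).Reachable s c) ∧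
          (openGraph (labelledOpen ends (clusterFlip ends a fun x => !z x))).Reachable s c).card +
      (univ.filter fun z : α → Bool =>
        ((openGraph (labelledOpen ends z)).Reachable a s ∧ ¬ (openGraph (labelledOpen ends z)).Reachable a c) ∧
          (openGraph (labelledOpen ends (clusterFlip ends a fun x => !z x))).Reachable s c).card) ^ 2 ≤
    (univ.filter fun z : α → Bool =>
        (openGraph (labelledOpen ends z)).Reachable a s ∧ ¬ (openGraph (labelledOpen ends z)).Reachable a c).card *
    (univ.filter fun z : α → Bool =>
        (openGraph (labelledOpen ends z)).Reachable a s ∧ (openGraph (labelledOpen ends z)).Reachable a c).card := by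
  set T : Set V := {v : V | v ∉ A ∧ v ≠ u} with hT
  have hsepT := separates_compl ends u A hsep
  have huT : u ∉ T := fun h => h.2 rfl
  have hsT : s ∈ T ∨ s = u := Or.inl ⟨hs, hsu⟩
  have hcT : c ∈ T ∨ c = u := Or.inl ⟨hc, hcu⟩
  let ins : α → Prop := fun l => (∀ v ∈ ends l, v ∈ A ∨ v = u) ∧ ¬ (ends l).IsDiag
  have hagA : ∀ z z' : α → Bool, (∀ l, ins l → z l = z' l) →
      ∀ l, (∀ v ∈ ends l, v ∈ A ∨ v = u) → ¬ (ends l).IsDiag → z l = z' l :=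
    fun z z' h l hl hd => h l ⟨hl, hd⟩
  have hagT : ∀ z z' : α → Bool, (∀ l, ¬ ins l → z l = z' l) →
      ∀ l, (∀ v ∈ ends l, v ∈ T ∨ v = u) → ¬ (ends l).IsDiag → z l = z' l := by
    intro z z' h l hl hd
    refine h l fun hins => hd (isDiag_of_forall_eq (a := u) fun v hv => ?_)
    rcases hins.1 v hv with h1 | h1
    · rcases hl v hv with h2 | h2
      · exact absurd h1 h2.1
      · exact h2
    · exact h1
  have hCn_in : ∀ z z' : α → Bool, (∀ l, ins l → z l = z' l) →
      (openGraph (labelledOpen ends z)).Reachable a u → (openGraph (labelledOpen ends z')).Reachable a u :=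
    fun z z' h hz => ((reachable_iff_of_agree_inside ends u A hsep huA (hagA z z' h) (Or.inl ha)).1 hz.symm).symm
  have hflatT : ∀ z z' : α → Bool, (∀ l, ¬ ins l → z l = z' l) →
      ∀ l, (∀ v ∈ ends l, v ∈ T ∨ v = u) → ¬ (ends l).IsDiag →
        clusterFlip ends u (fun x => !z x) l = clusterFlip ends u (fun x => !z' x) l :=
    fun z z' h l hl hd => flat_apply_eq_of_agree ends u T hsepT huT (hagT z z' h) hl hd
  have hRo : ∀ z z' : α → Bool, (∀ l, ¬ ins l → z l = z' l) → ∀ {x y : V}, (x ∈ T ∨ x = u) → (y ∈ T ∨ y = u) →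
      ((openGraph (labelledOpen ends z)).Reachable x y ↔ (openGraph (labelledOpen ends z')).Reachable x y) :=
    fun z z' h x y hx hy => reachable_iff_of_agree_outside ends u A hsep huA (hagT z z' h) hx hy
  have hFo : ∀ z z' : α → Bool, (∀ l, ¬ ins l → z l = z' l) →
      ((openGraph (labelledOpen ends (clusterFlip ends u fun x => !z x))).Reachable s c ↔
        (openGraph (labelledOpen ends (clusterFlip ends u fun x => !z' x))).Reachable s c) :=
    fun z z' h => reachable_iff_of_agree_outside ends u A hsep huA (hflatT z z' h) hsT hcT
  have hbad_out : ∀ z z' : α → Bool, (∀ l, ¬ ins l → z l = z' l) →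
      ((¬ (openGraph (labelledOpen ends z)).Reachable u s ∧ ¬ (openGraph (labelledOpen ends z)).Reachable u c ∧
          ¬ (openGraph (labelledOpen ends z)).Reachable s c) ∧
        (openGraph (labelledOpen ends (clusterFlip ends u fun x => !z x))).Reachable s c) →
      ((¬ (openGraph (labelledOpen ends z')).Reachable u s ∧ ¬ (openGraph (labelledOpen ends z')).Reachable u c ∧
          ¬ (openGraph (labelledOpen ends z')).Reachable s c) ∧
        (openGraph (labelledOpen ends (clusterFlip ends u fun x => !z' x))).Reachable s c) := by
    rintro z z' h ⟨⟨h1, h2, h3⟩, h4⟩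
    exact ⟨⟨fun h' => h1 ((hRo z z' h (Or.inr rfl) hsT).2 h'), fun h' => h2 ((hRo z z' h (Or.inr rfl) hcT).2 h'),
      fun h' => h3 ((hRo z z' h hsT hcT).2 h')⟩, (hFo z z' h).1 h4⟩
  have hw_out : ∀ z z' : α → Bool, (∀ l, ¬ ins l → z l = z' l) →
      (((openGraph (labelledOpen ends z)).Reachable u s ∧ ¬ (openGraph (labelledOpen ends z)).Reachable u c) ∧
        (openGraph (labelledOpen ends (clusterFlip ends u fun x => !z x))).Reachable s c) →
      (((openGraph (labelledOpen ends z')).Reachable u s ∧ ¬ (openGraph (labelledOpen ends z')).Reachable u c) ∧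
        (openGraph (labelledOpen ends (clusterFlip ends u fun x => !z' x))).Reachable s c) := by
    rintro z z' h ⟨⟨h1, h2⟩, h4⟩
    exact ⟨⟨(hRo z z' h (Or.inr rfl) hsT).1 h1, fun h' => h2 ((hRo z z' h (Or.inr rfl) hcT).2 h')⟩, (hFo z z' h).1 h4⟩
  have hP1_out : ∀ z z' : α → Bool, (∀ l, ¬ ins l → z l = z' l) →
      ((openGraph (labelledOpen ends z)).Reachable u s ∧ ¬ (openGraph (labelledOpen ends z)).Reachable u c) →
      ((openGraph (labelledOpen ends z')).Reachable u s ∧ ¬ (openGraph (labelledOpen ends z')).Reachable u c) := by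
    rintro z z' h ⟨h1, h2⟩
    exact ⟨(hRo z z' h (Or.inr rfl) hsT).1 h1, fun h' => h2 ((hRo z z' h (Or.inr rfl) hcT).2 h')⟩
  have hJ_out : ∀ z z' : α → Bool, (∀ l, ¬ ins l → z l = z' l) →
      ((openGraph (labelledOpen ends z)).Reachable u s ∧ (openGraph (labelledOpen ends z)).Reachable u c) →
      ((openGraph (labelledOpen ends z')).Reachable u s ∧ (openGraph (labelledOpen ends z')).Reachable u c) := by
    rintro z z' h ⟨h1, h2⟩
    exact ⟨(hRo z z' h (Or.inr rfl) hsT).1 h1, (hRo z z' h (Or.inr rfl) hcT).1 h2⟩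
  have ebad := Finset.filter_congr (s := (univ : Finset (α → Bool)))
    fun z _ => bad_iff_apexTransfer ends u A hsep huA ha hs hsu hc hcu z
  have ew := Finset.filter_congr (s := (univ : Finset (α → Bool)))
    fun z _ => w_iff_apexTransfer ends u A hsep huA (c := c) ha hs z
  have eP1 := Finset.filter_congr (s := (univ : Finset (α → Bool)))
    fun z _ => sa_iff_apexTransfer ends u A hsep huA (c := c) ha hs z
  have eJ := Finset.filter_congr (s := (univ : Finset (α → Bool)))
    fun z _ => joined_iff_apexTransfer ends u A hsep huA (c := c) ha hs hc z
  rw [ebad, ew, eP1, eJ]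
  have hIbad := card_and_mul_card_univ ins
    (fun z => (openGraph (labelledOpen ends z)).Reachable a u)
    (fun z => (¬ (openGraph (labelledOpen ends z)).Reachable u s ∧ ¬ (openGraph (labelledOpen ends z)).Reachable u c ∧
          ¬ (openGraph (labelledOpen ends z)).Reachable s c) ∧
        (openGraph (labelledOpen ends (clusterFlip ends u fun x => !z x))).Reachable s c)
    hCn_in hbad_out
  have hIw := card_and_mul_card_univ ins
    (fun z => (openGraph (labelledOpen ends z)).Reachable a u)
    (fun z => ((openGraph (labelledOpen ends z)).Reachable u s ∧ ¬ (openGraph (labelledOpen ends z)).Reachable u c) ∧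
        (openGraph (labelledOpen ends (clusterFlip ends u fun x => !z x))).Reachable s c)
    hCn_in hw_out
  have hIP1 := card_and_mul_card_univ ins
    (fun z => (openGraph (labelledOpen ends z)).Reachable a u)
    (fun z => (openGraph (labelledOpen ends z)).Reachable u s ∧ ¬ (openGraph (labelledOpen ends z)).Reachable u c)
    hCn_in hP1_out
  have hIJ := card_and_mul_card_univ ins
    (fun z => (openGraph (labelledOpen ends z)).Reachable a u)
    (fun z => (openGraph (labelledOpen ends z)).Reachable u s ∧ (openGraph (labelledOpen ends z)).Reachable u c)
    hCn_in hJ_out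
  beta_reduce at hIbad hIw hIP1 hIJ
  set U := (univ : Finset (α → Bool)).card with hU
  set Cn := (univ.filter fun z : α → Bool => (openGraph (labelledOpen ends z)).Reachable a u).card with hCn
  set Bu := (univ.filter fun z : α → Bool =>
        (¬ (openGraph (labelledOpen ends z)).Reachable u s ∧ ¬ (openGraph (labelledOpen ends z)).Reachable u c ∧
            ¬ (openGraph (labelledOpen ends z)).Reachable s c) ∧
          (openGraph (labelledOpen ends (clusterFlip ends u fun x => !z x))).Reachable s c).card with hBu
  set Wu := (univ.filter fun z : α → Bool =>
        ((openGraph (labelledOpen ends z)).Reachable u s ∧ ¬ (openGraph (labelledOpen ends z)).Reachable u c) ∧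
          (openGraph (labelledOpen ends (clusterFlip ends u fun x => !z x))).Reachable s c).card with hWu
  set Q1u := (univ.filter fun z : α → Bool =>
        (openGraph (labelledOpen ends z)).Reachable u s ∧ ¬ (openGraph (labelledOpen ends z)).Reachable u c).card with hQ1u
  set Ju := (univ.filter fun z : α → Bool =>
        (openGraph (labelledOpen ends z)).Reachable u s ∧ (openGraph (labelledOpen ends z)).Reachable u c).card with hJu
  set Ba := (univ.filter fun z : α → Bool => (openGraph (labelledOpen ends z)).Reachable a u ∧
        ((¬ (openGraph (labelledOpen ends z)).Reachable u s ∧ ¬ (openGraph (labelledOpen ends z)).Reachable u c ∧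
            ¬ (openGraph (labelledOpen ends z)).Reachable s c) ∧
          (openGraph (labelledOpen ends (clusterFlip ends u fun x => !z x))).Reachable s c)).card with hBa
  set Wa := (univ.filter fun z : α → Bool => (openGraph (labelledOpen ends z)).Reachable a u ∧
        (((openGraph (labelledOpen ends z)).Reachable u s ∧ ¬ (openGraph (labelledOpen ends z)).Reachable u c) ∧
          (openGraph (labelledOpen ends (clusterFlip ends u fun x => !z x))).Reachable s c)).card with hWa
  set Q1a := (univ.filter fun z : α → Bool => (openGraph (labelledOpen ends z)).Reachable a u ∧
        ((openGraph (labelledOpen ends z)).Reachable u s ∧ ¬ (openGraph (labelledOpen ends z)).Reachable u c)).card with hQ1a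
  set Ja := (univ.filter fun z : α → Bool => (openGraph (labelledOpen ends z)).Reachable a u ∧
        ((openGraph (labelledOpen ends z)).Reachable u s ∧ (openGraph (labelledOpen ends z)).Reachable u c)).card with hJa
  have hUpos : 0 < U := Finset.card_pos.mpr Finset.univ_nonempty
  have key : ((Ba + Wa) * U) ^ 2 ≤ (Q1a * U) * (Ja * U) := by
    rw [add_mul, hIbad, hIw, hIP1, hIJ]
    calc (Cn * Bu + Cn * Wu) ^ 2 = (Cn * Cn) * (Bu + Wu) ^ 2 := by ring
      _ ≤ (Cn * Cn) * (Q1u * Ju) := Nat.mul_le_mul_left _ hS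
      _ = Cn * Q1u * (Cn * Ju) := by ring
  have key' : (Ba + Wa) ^ 2 * (U * U) ≤ Q1a * Ja * (U * U) := by
    calc (Ba + Wa) ^ 2 * (U * U) = ((Ba + Wa) * U) ^ 2 := by ring
      _ ≤ (Q1a * U) * (Ja * U) := key
      _ = Q1a * Ja * (U * U) := by ring
  exact Nat.le_of_mul_le_mul_right key' (Nat.mul_pos hUpos hUpos)

open Classical in
/-- **(S1J′) TRANSFERS ACROSS R1** (the statement of `S1J_of_apexTransfer` with `s` and `c` exchanged, rearranged). [this work] -/
theorem S1Jc_of_apexTransfer (ends : α → Sym2 V) (u a s c : V) (A : Set V)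
    (hsep : ∀ l : α, (∀ v ∈ ends l, v ∈ A ∨ v = u) ∨ (∀ v ∈ ends l, v ∉ A ∨ v = u))
    (huA : u ∉ A) (ha : a ∈ A) (hs : s ∉ A) (hsu : s ≠ u) (hc : c ∉ A) (hcu : c ≠ u)
    (hS : ((univ.filter fun z : α → Bool =>
        (¬ (openGraph (labelledOpen ends z)).Reachable u s ∧ ¬ (openGraph (labelledOpen ends z)).Reachable u c ∧
            ¬ (openGraph (labelledOpen ends z)).Reachable s c) ∧
          (openGraph (labelledOpen ends (clusterFlip ends u fun x => !z x))).Reachable s c).card +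
        (univ.filter fun z : α → Bool =>
          ((openGraph (labelledOpen ends z)).Reachable u c ∧ ¬ (openGraph (labelledOpen ends z)).Reachable u s) ∧
            (openGraph (labelledOpen ends (clusterFlip ends u fun x => !z x))).Reachable s c).card) ^ 2 ≤
      (univ.filter fun z : α → Bool =>
        (openGraph (labelledOpen ends z)).Reachable u c ∧ ¬ (openGraph (labelledOpen ends z)).Reachable u s).card *
      (univ.filter fun z : α → Bool =>
        (openGraph (labelledOpen ends z)).Reachable u s ∧ (openGraph (labelledOpen ends z)).Reachable u c).card) :
    ((univ.filter fun z : α → Bool =>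
        (¬ (openGraph (labelledOpen ends z)).Reachable a s ∧ ¬ (openGraph (labelledOpen ends z)).Reachable a c ∧
            ¬ (openGraph (labelledOpen ends z)).Reachable s c) ∧
          (openGraph (labelledOpen ends (clusterFlip ends a fun x => !z x))).Reachable s c).card +
      (univ.filter fun z : α → Bool =>
        ((openGraph (labelledOpen ends z)).Reachable a c ∧ ¬ (openGraph (labelledOpen ends z)).Reachable a s) ∧
          (openGraph (labelledOpen ends (clusterFlip ends a fun x => !z x))).Reachable s c).card) ^ 2 ≤
    (univ.filter fun z : α → Bool =>
        (openGraph (labelledOpen ends z)).Reachable a c ∧ ¬ (openGraph (labelledOpen ends z)).Reachable a s).card *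
    (univ.filter fun z : α → Bool =>
        (openGraph (labelledOpen ends z)).Reachable a s ∧ (openGraph (labelledOpen ends z)).Reachable a c).card := by
  -- apply the transfer with `s` and `c` exchanged, then restore the order of the conjuncts
  have h := S1J_of_apexTransfer ends u a c s A hsep huA ha hc hcu hs hsu ?_
  · have e1 : (univ.filter fun z : α → Bool =>
          (¬ (openGraph (labelledOpen ends z)).Reachable a c ∧ ¬ (openGraph (labelledOpen ends z)).Reachable a s ∧
              ¬ (openGraph (labelledOpen ends z)).Reachable c s) ∧
            (openGraph (labelledOpen ends (clusterFlip ends a fun x => !z x))).Reachable c s) =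
        (univ.filter fun z : α → Bool =>
          (¬ (openGraph (labelledOpen ends z)).Reachable a s ∧ ¬ (openGraph (labelledOpen ends z)).Reachable a c ∧
              ¬ (openGraph (labelledOpen ends z)).Reachable s c) ∧
            (openGraph (labelledOpen ends (clusterFlip ends a fun x => !z x))).Reachable s c) := by
      refine Finset.filter_congr fun z _ => ?_
      constructor
      · rintro ⟨⟨h1, h2, h3⟩, h4⟩; exact ⟨⟨h2, h1, fun h' => h3 h'.symm⟩, h4.symm⟩
      · rintro ⟨⟨h1, h2, h3⟩, h4⟩; exact ⟨⟨h2, h1, fun h' => h3 h'.symm⟩, h4.symm⟩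
    have e2 : (univ.filter fun z : α → Bool =>
          ((openGraph (labelledOpen ends z)).Reachable a c ∧ ¬ (openGraph (labelledOpen ends z)).Reachable a s) ∧
            (openGraph (labelledOpen ends (clusterFlip ends a fun x => !z x))).Reachable c s) =
        (univ.filter fun z : α → Bool =>
          ((openGraph (labelledOpen ends z)).Reachable a c ∧ ¬ (openGraph (labelledOpen ends z)).Reachable a s) ∧
            (openGraph (labelledOpen ends (clusterFlip ends a fun x => !z x))).Reachable s c) :=
      Finset.filter_congr fun z _ => by
        constructor
        · rintro ⟨h1, h4⟩; exact ⟨h1, h4.symm⟩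
        · rintro ⟨h1, h4⟩; exact ⟨h1, h4.symm⟩
    have e3 : (univ.filter fun z : α → Bool =>
          (openGraph (labelledOpen ends z)).Reachable a c ∧ (openGraph (labelledOpen ends z)).Reachable a s) =
        (univ.filter fun z : α → Bool =>
          (openGraph (labelledOpen ends z)).Reachable a s ∧ (openGraph (labelledOpen ends z)).Reachable a c) :=
      Finset.filter_congr fun z _ => and_comm
    rw [e1, e2, e3] at h
    exact h
  · have e1 : (univ.filter fun z : α → Bool =>
          (¬ (openGraph (labelledOpen ends z)).Reachable u c ∧ ¬ (openGraph (labelledOpen ends z)).Reachable u s ∧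
              ¬ (openGraph (labelledOpen ends z)).Reachable c s) ∧
            (openGraph (labelledOpen ends (clusterFlip ends u fun x => !z x))).Reachable c s) =
        (univ.filter fun z : α → Bool =>
          (¬ (openGraph (labelledOpen ends z)).Reachable u s ∧ ¬ (openGraph (labelledOpen ends z)).Reachable u c ∧
              ¬ (openGraph (labelledOpen ends z)).Reachable s c) ∧
            (openGraph (labelledOpen ends (clusterFlip ends u fun x => !z x))).Reachable s c) := by
      refine Finset.filter_congr fun z _ => ?_
      constructor
      · rintro ⟨⟨h1, h2, h3⟩, h4⟩; exact ⟨⟨h2, h1, fun h' => h3 h'.symm⟩, h4.symm⟩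
      · rintro ⟨⟨h1, h2, h3⟩, h4⟩; exact ⟨⟨h2, h1, fun h' => h3 h'.symm⟩, h4.symm⟩
    have e2 : (univ.filter fun z : α → Bool =>
          ((openGraph (labelledOpen ends z)).Reachable u c ∧ ¬ (openGraph (labelledOpen ends z)).Reachable u s) ∧
            (openGraph (labelledOpen ends (clusterFlip ends u fun x => !z x))).Reachable c s) =
        (univ.filter fun z : α → Bool =>
          ((openGraph (labelledOpen ends z)).Reachable u c ∧ ¬ (openGraph (labelledOpen ends z)).Reachable u s) ∧
            (openGraph (labelledOpen ends (clusterFlip ends u fun x => !z x))).Reachable s c) :=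
      Finset.filter_congr fun z _ => by
        constructor
        · rintro ⟨h1, h4⟩; exact ⟨h1, h4.symm⟩
        · rintro ⟨h1, h4⟩; exact ⟨h1, h4.symm⟩
    have e3 : (univ.filter fun z : α → Bool =>
          (openGraph (labelledOpen ends z)).Reachable u c ∧ (openGraph (labelledOpen ends z)).Reachable u s) =
        (univ.filter fun z : α → Bool =>
          (openGraph (labelledOpen ends z)).Reachable u s ∧ (openGraph (labelledOpen ends z)).Reachable u c) :=
      Finset.filter_congr fun z _ => and_comm
    rw [e1, e2, e3]
    exact hS

end TransferS1J

end Summit.CriticalPhenomena.PercolationContinuityZ3.Theorems.ProductFormFibre
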